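import Literature.NumberTheory.IwasawaTheory.ClassicalMuVanishesReflectionLayer
import Literature.NumberTheory.IwasawaTheory.ClassicalMuVanishesIffBoundedRank
import Literature.NumberTheory.IwasawaTheory.ClassNumberPExpZeroCyclotomicSubfield
import Mathlib.NumberTheory.Padics.HeightOneSpectrum
import HarnessLib

set_option autoImplicit false

/-!
# Leopoldt–Scholz REFLECTION up the cyclotomic `ℤ_p`-tower, II: `μ = 0` for the REAL mirror — and for the whole CM biquadratic
# configuration — from `μ = 0` of the IMAGINARY mirrors ALONE (the algebraic half of Ferrero–Washington, in the kernel); the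
# `p = 3` Borel/Scholz form (theorem-only; no named fact, no `sorry`)

Topic `NumberTheory/IwasawaTheory` (namespace = path).  THEOREM-ONLY file written by the prover seat `bsd-potss-rkm` (generation 36,
cell `bsd-potss`; `--supports` stmt-BirchSwinnertonDyer-19196, crux M `ReducibleKatoMember` of the routes K9 `KatoDescentPotSupersingular` /
K8-t′ `KatoDescentTamePotSupersingular`; closes nothing).  Part I (`ClassicalMuVanishesReflectionLayer.lean`) proves the layerwise
inequality `rank_p Cl((L^{⟨z⟩}F_∞)_n) + 2 rank_p Cl((L^{⟨z,b⟩}F_∞)_n) ≤ 1 + rank_p Cl((L^{⟨b⟩}F_∞)_n) + rank_p Cl((L^{⟨zb⟩}F_∞)_n)`.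

## Why (the consumer)

On a reducible row of an elliptic curve `E/ℚ` at an odd prime `p` (`E[p]^{ss} = χ₁ ⊕ χ₂`, `χ₁χ₂ = ω`), the only place where
Ferrero–Washington enters the kernel chain of crux M / Coates–Sujatha's (A) is `ClassicalMuVanishes` for the cyclotomic
`ℤ_p`-tower of the BOREL FIELD `ℚ(χ₁, χ₂)` (tree `…Theorems.ReducibleFineSelmerMuZeroCharForm.fineSelmerInfty_torsion_finite_of_reducible`).
Since `χ₁χ₂ = ω`, exactly one of `χ₁, χ₂` is even: `{χ₁, χ₂}` is a LEOPOLDT MIRROR PAIR.  At `p = 3` the Borel field is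
`L = ℚ(√d, √−3)` (`{χ₁,χ₂} = {χ_d, χ_{−3d}}`), CM biquadratic containing `ζ₃`, with quadratic subfields `ℚ(√d)`, `ℚ(√−3) = ℚ(ζ₃)`,
`ℚ(√−3d)`; the tree's fact-free Kuroda descent gives `μ(L) = 0` from `μ = 0` of the three quadratic towers, of which `ℚ(ζ₃)` is free
(Iwasawa 1956, `h = 1`).  THIS FILE removes the REAL quadratic input: with «`μ = 0` ⟺ bounded `p`-ranks» (tree
`classicalMuVanishes_iff_exists_forall_classGroupPRank_le`, Washington Prop. 13.23 at finite level) the layerwise reflection inequality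
gives **`μ(L^{⟨b⟩}F_∞) = μ(L^{⟨zb⟩}F_∞) = 0 ⟹ μ(L^{⟨z⟩}F_∞) = 0`**, and then `μ(L·F_∞) = 0` by the Kuroda descent with its `L^{⟨z⟩}`
input REMOVED.  This is the ALGEBRAIC HALF («`μ⁺ ≤ μ⁻`», reflection) of Ferrero–Washington's theorem in the tree's numerical currency;
the analytic half (`μ⁻ = 0`) remains the input.  Net effect: the `μ`-input of M / (A) on EVERY reducible row at `p = 3` is
`μ₃ = 0` for ONE imaginary quadratic field `ℚ(√δ)` (`δ` the negative one of `d, −3d`) — Ferrero 1978 class-wide, or, per row,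
Iwasawa 1956 «`3 ∤ h(ℚ(√δ))` and one prime above `3`» on that field ALONE (no condition on the real field, where `3` may split).

## Main results

* `classicalMuVanishes_restrict_real_of_mirror`, `classicalMuVanishes_restrict_of_reflection` — `μ = 0` for `L^{⟨z⟩}` (resp. `L`)
  from `μ = 0` of `L^{⟨b⟩}`, `L^{⟨zb⟩}` (resp. and `L^{⟨z,b⟩}`), growth form, fact-free.
* `classicalMuVanishes_of_isCyclotomic_real_of_mirror`, `classicalMuVanishes_of_isCyclotomic_of_reflection` — «∀ cyclotomic» forms
  (`p ∤ [L : F]`).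
* `classicalMuVanishes_rat` — `μ = 0` for every `ℤ_p`-extension of `ℚ` (Iwasawa 1956 `_holds`, `h(ℚ) = 1`, one prime above `p`).
* `classicalMuVanishes_of_isCyclotomic_of_reflection_rat`, `…_real_of_mirror_rat` — the biquadratic CM form over `ℚ`
  (`Gal(L/ℚ) = ⟨z, b⟩`): inputs `L^{⟨b⟩}`, `L^{⟨zb⟩}` only.
* `classicalMuVanishes_of_isCyclotomic_of_imaginaryMirror_three`, `…_real_of_imaginaryMirror_three` — `p = 3`, `L^{⟨b⟩}` a `3`rd
  cyclotomic extension of `ℚ` (`h = 1`): **`μ₃(L) = 0` and `μ₃(L^{⟨z⟩}) = 0` from «`μ = 0` for the cyclotomic `ℤ₃`-tower of the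
  imaginary mirror `L^{⟨zb⟩}`» ALONE** — for `L = ℚ(√d, √−3)`: `μ₃(ℚ(√d, √−3)) = 0 ∧ μ₃(ℚ(√d)) = 0 ⟸ μ₃(ℚ(√−3d)) = 0`.

## What is NOT here (honest scope)

No `p`-adic `L`-function, no proof of `μ⁻ = 0` (Ferrero–Washington's analytic half stays a named input wherever it is used); no
isotypic refinement for `p ≥ 5` (there the Borel field has more odd characters than the mirror of `χ_even`; the reduction of the
input to ONE cyclic field needs an isotypic dévissage — `-- TODO(general form): component-wise Spiegelungssatz [Washington1997,
Thm. 10.11]`); nothing about elliptic curves (the consumer lives in `Summits/…/Theorems/`).  BSD is advanced for no curve.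

## References

* S. Lang, *Cyclotomic Fields I and II*, GTM 121 (1990), Ch. 13 §2, Thm. 2.1 (i) (pp. 199–200). [Lang1990]
* L. C. Washington, *Introduction to Cyclotomic Fields*, 2nd ed., GTM 83 (1997): §10.2 (Thm. 10.10 Scholz, Thm. 10.11 Leopoldt),
  §13.1, §13.3 Prop. 13.23, §7.5 (Ferrero–Washington). [Washington1997]
* F. Lemmermeyer, *Kuroda's class number formula*, Acta Arith. 66 (1994) 245–260, §1. [Lemmermeyer1994]
* R. Greenberg, *Iwasawa theory — past and present*, Adv. Stud. Pure Math. 30 (2001), Prop. 2.1 (p. 339). [Greenberg2001IwasawaPastPresent]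
* B. Ferrero, Math. Ann. 234 (1978) 9–24; B. Ferrero, L. C. Washington, Ann. of Math. 109 (1979) 377–395 — context (the input this
  file halves). [Ferrero1978] [FerreroWashington1979]
* Tree: `IwasawaTheory/ClassicalMuVanishesReflectionLayer.lean` (Part I), `IwasawaTheory/ClassicalMuVanishesKurodaTower.lean`,
  `IwasawaTheory/ClassicalMuVanishesIffBoundedRank.lean`, `IwasawaTheory/ClassNumberPExpZeroCyclotomicSubfield.lean`,
  `IwasawaTheory/ClassicalMuInvariantOnePrimeProofs.lean`; Mathlib `NumberTheory/Padics/HeightOneSpectrum`.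
-/

noncomputable section

open scoped NumberField

open Field IntermediateField NumberField NumberField.InfinitePlace
  Literature.NumberTheory.GaloisRepresentations Literature.NumberTheory.EllipticCurves
  Literature.NumberTheory.EllipticCurves.ZpExtension Literature.NumberTheory.NumberFields

namespace Literature.NumberTheory.IwasawaTheory

section Descent

variable {F : Type} [Field F] [NumberField F] {p : ℕ} [hp : Fact p.Prime]

/-! ### §4 μ-descent by reflection: `μ(L^{⟨z⟩}) = 0` from `μ(L^{⟨b⟩}) = μ(L^{⟨zb⟩}) = 0`; then `μ(L) = 0` -/

/-- **`μ = 0` FOR THE REAL MIRROR FROM `μ = 0` OF THE ODD MIRRORS (growth form; fact-free).**  In the setting of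
`classGroupPRank_restrict_reflection_le`: if the restricted towers over `L^{⟨b⟩}` and `L^{⟨zb⟩}` have `μ = 0`
(`ClassicalMuVanishes`, growth form) then so does the restricted tower over the totally real `L^{⟨z⟩}` — via «`μ = 0` ⟺
bounded `p`-ranks» (tree `classicalMuVanishes_iff_exists_forall_classGroupPRank_le`, Washington Prop. 13.23 at finite
level) and the layerwise reflection inequality.  This is the ALGEBRAIC HALF of Ferrero–Washington's theorem («`μ⁺ ≤ μ⁻`»,
reflection) in the tree's numerical currency; the analytic half (`μ⁻ = 0`) stays an input.
[cite: Washington1997, §10.2 Thm. 10.11, §13.3 Prop. 13.23, §7.5 (Ferrero–Washington)] [cite: Lang1990, Ch. 13 §2, Thm. 2.1 (i)] -/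
theorem classicalMuVanishes_restrict_real_of_mirror [IsTotallyReal F] (hp2 : p ≠ 2) (κ : ZpExtension F p) (L : Type)
    [Field L] [NumberField L] [Algebra F L] [IsGalois F L] [IsTotallyComplex L]
    (hL : Function.Surjective (κ.toContinuousMonoidHom.comp (absGaloisRestrict F L)))
    {ζ : L} (hζ : IsPrimitiveRoot ζ p) {z b : L ≃ₐ[F] L} (hz : z * z = 1) (hb : b * b = 1) (hzb : z * b = b * z)
    (hz1 : z ≠ 1) (hreal : IsTotallyReal ↥(fixedField (Subgroup.zpowers z)))
    (hZ : Function.Surjective (κ.toContinuousMonoidHom.comp (absGaloisRestrict F ↥(fixedField (Subgroup.zpowers z)))))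
    (hB : Function.Surjective (κ.toContinuousMonoidHom.comp (absGaloisRestrict F ↥(fixedField (Subgroup.zpowers b)))))
    (hZB' : Function.Surjective
      (κ.toContinuousMonoidHom.comp (absGaloisRestrict F ↥(fixedField (Subgroup.zpowers (z * b))))))
    (hC : Function.Surjective
      (κ.toContinuousMonoidHom.comp (absGaloisRestrict F ↥(fixedField (Subgroup.closure {z, b})))))
    (hμB : ClassicalMuVanishes (κ.restrict ↥(fixedField (Subgroup.zpowers b)) hB))
    (hμZB : ClassicalMuVanishes (κ.restrict ↥(fixedField (Subgroup.zpowers (z * b))) hZB')) :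
    ClassicalMuVanishes (κ.restrict ↥(fixedField (Subgroup.zpowers z)) hZ) := by
  obtain ⟨B₁, hB₁⟩ := exists_forall_classGroupPRank_le_of_classicalMuVanishes _ hμB
  obtain ⟨B₂, hB₂⟩ := exists_forall_classGroupPRank_le_of_classicalMuVanishes _ hμZB
  refine classicalMuVanishes_of_forall_classGroupPRank_le _ (B := 1 + B₁ + B₂) fun m => ?_
  have h := classGroupPRank_restrict_reflection_le hp2 κ L hL hζ hz hb hzb hz1 hreal hZ hB hZB' hC m
  have h1 := hB₁ m
  have h2 := hB₂ m
  omega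

/-- **Klein/Kuroda μ-descent WITH THE REAL-FIELD INPUT REMOVED.**  Same setting: `μ = 0` (growth form) for the restricted
towers over `L^{⟨b⟩}`, `L^{⟨zb⟩}` and `L^{⟨z,b⟩}` ALONE gives `μ = 0` for `L·F_∞/L` — the tree's fact-free Kuroda descent
`classicalMuVanishes_restrict_of_biquadratic` with its `L^{⟨z⟩}`-input supplied by reflection.
[cite: Lemmermeyer1994, §1 (Kuroda's class number formula, odd part)] [cite: Lang1990, Ch. 13 §2, Thm. 2.1 (i)]
[cite: Washington1997, §10.2, §13.1, §13.3 Prop. 13.23] -/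
theorem classicalMuVanishes_restrict_of_reflection [IsTotallyReal F] (hp2 : p ≠ 2) (κ : ZpExtension F p) (L : Type)
    [Field L] [NumberField L] [Algebra F L] [IsGalois F L] [IsTotallyComplex L]
    (hL : Function.Surjective (κ.toContinuousMonoidHom.comp (absGaloisRestrict F L)))
    {ζ : L} (hζ : IsPrimitiveRoot ζ p) {z b : L ≃ₐ[F] L} (hz : z * z = 1) (hb : b * b = 1) (hzb : z * b = b * z)
    (hz1 : z ≠ 1) (hreal : IsTotallyReal ↥(fixedField (Subgroup.zpowers z)))
    (hZ : Function.Surjective (κ.toContinuousMonoidHom.comp (absGaloisRestrict F ↥(fixedField (Subgroup.zpowers z)))))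
    (hB : Function.Surjective (κ.toContinuousMonoidHom.comp (absGaloisRestrict F ↥(fixedField (Subgroup.zpowers b)))))
    (hZB' : Function.Surjective
      (κ.toContinuousMonoidHom.comp (absGaloisRestrict F ↥(fixedField (Subgroup.zpowers (z * b))))))
    (hC : Function.Surjective
      (κ.toContinuousMonoidHom.comp (absGaloisRestrict F ↥(fixedField (Subgroup.closure {z, b})))))
    (hμB : ClassicalMuVanishes (κ.restrict ↥(fixedField (Subgroup.zpowers b)) hB))
    (hμZB : ClassicalMuVanishes (κ.restrict ↥(fixedField (Subgroup.zpowers (z * b))) hZB'))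
    (hμC : ClassicalMuVanishes (κ.restrict ↥(fixedField (Subgroup.closure {z, b})) hC)) :
    ClassicalMuVanishes (κ.restrict L hL) :=
  classicalMuVanishes_restrict_of_biquadratic hp2 κ L hL hz hb hzb hZ hB hZB' hC
    (classicalMuVanishes_restrict_real_of_mirror hp2 κ L hL hζ hz hb hzb hz1 hreal hZ hB hZB' hC hμB hμZB) hμB hμZB hμC

/-! ### §5 «∀ cyclotomic» forms; the biquadratic form over `ℚ`; the `p = 3` cyclotomic mirror -/

omit [NumberField F] hp in
/-- `p ∤ [E : F]` for an intermediate field `E` of `L/F` when `p ∤ [L : F]`. [folklore] -/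
private theorem not_dvd_finrank_intermediateField'' {L : Type} [Field L] [Algebra F L] [FiniteDimensional F L]
    (hpL : ¬ p ∣ Module.finrank F L) (E : IntermediateField F L) : ¬ p ∣ Module.finrank F ↥E := fun h =>
  hpL (h.trans (Dvd.intro _ (Module.finrank_mul_finrank F ↥E L)))

/-- **«∀ cyclotomic» form of the reflection descent.**  `F` totally real, `p` odd, `L/F` finite Galois with `p ∤ [L : F]`,
`L` totally complex containing `ζ_p`, `z, b ∈ Gal(L/F)` commuting involutions, `z ≠ 1`, `L^{⟨z⟩}` totally real.  Then «`μ = 0` for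
every cyclotomic `ℤ_p`-extension» of `L^{⟨b⟩}` and of `L^{⟨zb⟩}` gives the same for the TOTALLY REAL `L^{⟨z⟩}`
(the even/real mirror from the odd ones). [cite: Lang1990, Ch. 13 §2, Thm. 2.1 (i)] [cite: Washington1997, §10.2, §13.1, §13.3 Prop. 13.23] -/
theorem classicalMuVanishes_of_isCyclotomic_real_of_mirror [IsTotallyReal F] (hp2 : p ≠ 2) (L : Type) [Field L]
    [NumberField L] [Algebra F L] [IsGalois F L] [IsTotallyComplex L] (hpL : ¬ p ∣ Module.finrank F L)
    {ζ : L} (hζ : IsPrimitiveRoot ζ p) {z b : L ≃ₐ[F] L} (hz : z * z = 1) (hb : b * b = 1) (hzb : z * b = b * z)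
    (hz1 : z ≠ 1) (hreal : IsTotallyReal ↥(fixedField (Subgroup.zpowers z)))
    (hμB : ∀ κE : ZpExtension ↥(fixedField (Subgroup.zpowers b)) p, κE.IsCyclotomic → ClassicalMuVanishes κE)
    (hμZB : ∀ κE : ZpExtension ↥(fixedField (Subgroup.zpowers (z * b))) p, κE.IsCyclotomic → ClassicalMuVanishes κE)
    (κZ : ZpExtension ↥(fixedField (Subgroup.zpowers z)) p) (hκZ : κZ.IsCyclotomic) : ClassicalMuVanishes κZ := by
  obtain ⟨κ, hκ⟩ := exists_cyclotomicZpExtension_holds F p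
  haveI : FiniteDimensional F L := Module.Finite.of_restrictScalars_finite ℚ F L
  have hs : ∀ E : IntermediateField F L, Function.Surjective
      (κ.toContinuousMonoidHom.comp (absGaloisRestrict F ↥E)) := fun E =>
    surjective_comp_absGaloisRestrict_of_not_dvd_finrank κ _ (not_dvd_finrank_intermediateField'' hpL E)
  have hL := surjective_comp_absGaloisRestrict_of_not_dvd_finrank κ L hpL
  have h1 : ClassicalMuVanishes (κ.restrict ↥(fixedField (Subgroup.zpowers z)) (hs _)) :=
    classicalMuVanishes_restrict_real_of_mirror hp2 κ L hL hζ hz hb hzb hz1 hreal (hs _) (hs _) (hs _)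
      (hs (fixedField (Subgroup.closure {z, b})))
      (hμB _ (isCyclotomic_restrict κ hκ _ (hs _))) (hμZB _ (isCyclotomic_restrict κ hκ _ (hs _)))
  exact (classicalMuVanishes_iff_of_isCyclotomic _ _ (isCyclotomic_restrict κ hκ _ (hs _)) hκZ).mp h1

/-- **«∀ cyclotomic» form for `L` itself**: under the same hypotheses plus «`μ = 0` for every cyclotomic `ℤ_p`-extension of
`L^{⟨z,b⟩}`», every cyclotomic `ℤ_p`-extension of `L` has `μ = 0` — the tree's `classicalMuVanishes_of_isCyclotomic_of_biquadratic`
with the `L^{⟨z⟩}` input REMOVED (supplied by reflection). [cite: Lemmermeyer1994, §1 (odd part)] [cite: Lang1990, Ch. 13 §2, Thm. 2.1 (i)]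
[cite: Washington1997, §10.2, §13.1] -/
theorem classicalMuVanishes_of_isCyclotomic_of_reflection [IsTotallyReal F] (hp2 : p ≠ 2) (L : Type) [Field L]
    [NumberField L] [Algebra F L] [IsGalois F L] [IsTotallyComplex L] (hpL : ¬ p ∣ Module.finrank F L)
    {ζ : L} (hζ : IsPrimitiveRoot ζ p) {z b : L ≃ₐ[F] L} (hz : z * z = 1) (hb : b * b = 1) (hzb : z * b = b * z)
    (hz1 : z ≠ 1) (hreal : IsTotallyReal ↥(fixedField (Subgroup.zpowers z)))
    (hμB : ∀ κE : ZpExtension ↥(fixedField (Subgroup.zpowers b)) p, κE.IsCyclotomic → ClassicalMuVanishes κE)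
    (hμZB : ∀ κE : ZpExtension ↥(fixedField (Subgroup.zpowers (z * b))) p, κE.IsCyclotomic → ClassicalMuVanishes κE)
    (hμC : ∀ κE : ZpExtension ↥(fixedField (Subgroup.closure {z, b})) p, κE.IsCyclotomic → ClassicalMuVanishes κE)
    (κL : ZpExtension L p) (hκL : κL.IsCyclotomic) : ClassicalMuVanishes κL :=
  classicalMuVanishes_of_isCyclotomic_of_biquadratic hp2 L hpL hz hb hzb
    (classicalMuVanishes_of_isCyclotomic_real_of_mirror hp2 L hpL hζ hz hb hzb hz1 hreal hμB hμZB) hμB hμZB hμC κL hκL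

/-- **`μ = 0` (indeed `e_n = 0`) for every `ℤ_p`-extension of `ℚ`** — Iwasawa 1956 (tree theorem
`iwasawa1956_classNumberPExp_eq_zero_of_not_dvd_classNumber_of_unique_prime_holds`) with `h(ℚ) = 1` (Mathlib `Rat.classNumber_eq`) and
the unique prime `(p)` of `ℤ` above `p` (Mathlib `Rat.HeightOneSpectrum.primesEquiv`). [cite: Greenberg2001IwasawaPastPresent, Prop. 2.1 p. 339]
[cite: Washington1997, Prop. 13.22 / §7.5 (`p ∤ h(ℚ_n)`)] -/
theorem classicalMuVanishes_rat (κ : ZpExtension ℚ p) : ClassicalMuVanishes κ := by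
  refine classicalMuVanishes_of_classNumberPExp_eq_zero
    iwasawa1956_classNumberPExp_eq_zero_of_not_dvd_classNumber_of_unique_prime_holds ?_ ?_ κ
  · rw [Rat.classNumber_eq, Nat.dvd_one]; exact hp.out.ne_one
  · have key : ∀ w : IsDedekindDomain.HeightOneSpectrum (𝓞 ℚ), ((p : ℕ) : 𝓞 ℚ) ∈ w.asIdeal ↔
        Rat.HeightOneSpectrum.natGenerator w = p := by
      intro w
      rw [← (Nat.prime_dvd_prime_iff_eq (Rat.HeightOneSpectrum.prime_natGenerator w) hp.out),
        Rat.HeightOneSpectrum.natGenerator_dvd_iff, ← map_natCast (Rat.IsIntegralClosure.intEquiv (𝓞 ℚ)) p,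
        Ideal.apply_mem_of_equiv_iff]
    refine ⟨Rat.HeightOneSpectrum.primesEquiv.symm ⟨p, hp.out⟩, ?_, fun w hw => ?_⟩
    · change ((p : ℕ) : 𝓞 ℚ) ∈ (Rat.HeightOneSpectrum.primesEquiv.symm ⟨p, hp.out⟩).asIdeal
      rw [key]
      exact congrArg Subtype.val (Rat.HeightOneSpectrum.primesEquiv.apply_symm_apply ⟨p, hp.out⟩)
    · apply Rat.HeightOneSpectrum.primesEquiv.injective
      rw [Equiv.apply_symm_apply]
      exact Subtype.ext ((key w).mp hw)

/-- **THE BIQUADRATIC CM FORM OVER `ℚ`.**  `L/ℚ` Galois with `Gal(L/ℚ) = ⟨z, b⟩` for commuting involutions `z ≠ 1`, `b`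
(`p` odd, `p ∤ [L : ℚ]`), `L` totally complex containing `ζ_p`, `L^{⟨z⟩}` totally real.  Then «`μ = 0` for every cyclotomic
`ℤ_p`-extension» of the two subfields `L^{⟨b⟩}`, `L^{⟨zb⟩}` gives it for `L` AND for the real subfield `L^{⟨z⟩}` — the
`L^{⟨z,b⟩} = ℚ` input is `classicalMuVanishes_rat`.  For `p = 3`, `L = ℚ(√d, √−3)`: `μ₃(ℚ(√d,√−3)) = 0` and `μ₃(ℚ(√d)) = 0` FROM
`μ₃(ℚ(√−3d)) = 0` alone (`L^{⟨b⟩} = ℚ(√−3)` has `μ = 0` by `classicalMuVanishes_of_isCyclotomicExtension_prime`, next theorem) —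
Scholz's reflection: the real half of Ferrero–Washington for quadratic fields is a theorem of the tree.
[cite: Washington1997, §10.2 Thm. 10.10 (Scholz), §7.5] [cite: Lang1990, Ch. 13 §2, Thm. 2.1 (i)] [cite: Lemmermeyer1994, §1] -/
theorem classicalMuVanishes_of_isCyclotomic_of_reflection_rat (hp2 : p ≠ 2) (L : Type) [Field L] [NumberField L]
    [IsGalois ℚ L] [IsTotallyComplex L] (hpL : ¬ p ∣ Module.finrank ℚ L) {ζ : L} (hζ : IsPrimitiveRoot ζ p)
    {z b : L ≃ₐ[ℚ] L} (hz : z * z = 1) (hb : b * b = 1) (hzb : z * b = b * z) (hz1 : z ≠ 1)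
    (htop : Subgroup.closure ({z, b} : Set (L ≃ₐ[ℚ] L)) = ⊤) (hreal : IsTotallyReal ↥(fixedField (Subgroup.zpowers z)))
    (hμB : ∀ κE : ZpExtension ↥(fixedField (Subgroup.zpowers b)) p, κE.IsCyclotomic → ClassicalMuVanishes κE)
    (hμZB : ∀ κE : ZpExtension ↥(fixedField (Subgroup.zpowers (z * b))) p, κE.IsCyclotomic → ClassicalMuVanishes κE)
    (κL : ZpExtension L p) (hκL : κL.IsCyclotomic) : ClassicalMuVanishes κL := by
  haveI : FiniteDimensional ℚ L := Module.Finite.of_restrictScalars_finite ℚ ℚ L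
  -- `L^{⟨z,b⟩} = ℚ`
  have hbot : fixedField (Subgroup.closure ({z, b} : Set (L ≃ₐ[ℚ] L))) = ⊥ := by rw [htop, IsGalois.fixedField_top]
  have φ : ℚ ≃ₐ[ℚ] ↥(fixedField (Subgroup.closure ({z, b} : Set (L ≃ₐ[ℚ] L)))) :=
    (IntermediateField.botEquiv ℚ L).symm.trans (IntermediateField.equivOfEq hbot.symm)
  have hμC : ∀ κE : ZpExtension ↥(fixedField (Subgroup.closure ({z, b} : Set (L ≃ₐ[ℚ] L)))) p,
      κE.IsCyclotomic → ClassicalMuVanishes κE :=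
    forall_classicalMuVanishes_of_algEquiv (F := ℚ) φ (by rw [Module.finrank_self]; exact hp.out.one_lt.ne' ∘ Nat.dvd_one.mp)
      (fun κE _ => classicalMuVanishes_rat κE)
  exact classicalMuVanishes_of_isCyclotomic_of_reflection hp2 L hpL hζ hz hb hzb hz1 hreal hμB hμZB hμC κL hκL

/-- The companion conclusion for the REAL subfield `L^{⟨z⟩}` over `ℚ` (e.g. `μ₃(ℚ(√d)) = 0` from `μ₃(ℚ(√−3d)) = 0` and
`μ₃(ℚ(√−3)) = 0`). [cite: Washington1997, §10.2 Thm. 10.10 (Scholz)] [cite: Lang1990, Ch. 13 §2, Thm. 2.1 (i)] -/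
theorem classicalMuVanishes_of_isCyclotomic_real_of_mirror_rat (hp2 : p ≠ 2) (L : Type) [Field L] [NumberField L]
    [IsGalois ℚ L] [IsTotallyComplex L] (hpL : ¬ p ∣ Module.finrank ℚ L) {ζ : L} (hζ : IsPrimitiveRoot ζ p)
    {z b : L ≃ₐ[ℚ] L} (hz : z * z = 1) (hb : b * b = 1) (hzb : z * b = b * z) (hz1 : z ≠ 1)
    (hreal : IsTotallyReal ↥(fixedField (Subgroup.zpowers z)))
    (hμB : ∀ κE : ZpExtension ↥(fixedField (Subgroup.zpowers b)) p, κE.IsCyclotomic → ClassicalMuVanishes κE)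
    (hμZB : ∀ κE : ZpExtension ↥(fixedField (Subgroup.zpowers (z * b))) p, κE.IsCyclotomic → ClassicalMuVanishes κE)
    (κZ : ZpExtension ↥(fixedField (Subgroup.zpowers z)) p) (hκZ : κZ.IsCyclotomic) : ClassicalMuVanishes κZ :=
  classicalMuVanishes_of_isCyclotomic_real_of_mirror hp2 L hpL hζ hz hb hzb hz1 hreal hμB hμZB κZ hκZ

/-- **THE `p = 3` BOREL/SCHOLZ FORM: only the IMAGINARY QUADRATIC MIRROR is an input.**  `L/ℚ` Galois, `3 ∤ [L : ℚ]`,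
`Gal(L/ℚ) = ⟨z, b⟩` commuting involutions with `z ≠ 1`, `L` totally complex with a primitive cube root of unity, `L^{⟨z⟩}` totally
real, and `L^{⟨b⟩}` a `3`rd CYCLOTOMIC extension of `ℚ` (`= ℚ(ζ₃) = ℚ(√−3)`, `h = 1`: Iwasawa 1956 + Mathlib `three_pid` via the
tree's `classicalMuVanishes_of_isCyclotomicExtension_prime`).  Then «`μ = 0` for every cyclotomic `ℤ₃`-extension of `L^{⟨zb⟩}`»
ALONE gives `μ = 0` for every cyclotomic `ℤ₃`-extension of `L`.  Reading: `L = ℚ(√d, √−3) = ℚ(χ₁, χ₂)` the Borel field of an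
elliptic curve over `ℚ` with reducible `E[3]` (`χ₁χ₂ = ω`), `L^{⟨zb⟩} = ℚ(√−3d)·(up to the choice of `b`) the imaginary quadratic
mirror: the `μ`-input of Coates–Sujatha's (A) / Kato's member bound on the reducible rows at `p = 3` is `μ₃ = 0` of ONE
imaginary quadratic field. [cite: Washington1997, §10.2 Thm. 10.10 (Scholz), §7.5] [cite: Lang1990, Ch. 13 §2, Thm. 2.1 (i)]
[cite: Greenberg2001IwasawaPastPresent, Prop. 2.1 p. 339] -/
theorem classicalMuVanishes_of_isCyclotomic_of_imaginaryMirror_three [Fact (3 : ℕ).Prime] (L : Type) [Field L]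
    [NumberField L] [IsGalois ℚ L] [IsTotallyComplex L] (h3L : ¬ 3 ∣ Module.finrank ℚ L) {ζ : L} (hζ : IsPrimitiveRoot ζ 3)
    {z b : L ≃ₐ[ℚ] L} (hz : z * z = 1) (hb : b * b = 1) (hzb : z * b = b * z) (hz1 : z ≠ 1)
    (htop : Subgroup.closure ({z, b} : Set (L ≃ₐ[ℚ] L)) = ⊤) (hreal : IsTotallyReal ↥(fixedField (Subgroup.zpowers z)))
    [IsCyclotomicExtension {3} ℚ ↥(fixedField (Subgroup.zpowers b))]
    (hμ : ∀ κE : ZpExtension ↥(fixedField (Subgroup.zpowers (z * b))) 3, κE.IsCyclotomic → ClassicalMuVanishes κE)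
    (κL : ZpExtension L 3) (hκL : κL.IsCyclotomic) : ClassicalMuVanishes κL := by
  refine classicalMuVanishes_of_isCyclotomic_of_reflection_rat (p := 3) (by decide) L h3L hζ hz hb hzb hz1 htop hreal
    (fun κE _ => ?_) hμ κL hκL
  haveI : FiniteDimensional ℚ L := Module.Finite.of_restrictScalars_finite ℚ ℚ L
  exact classicalMuVanishes_of_isCyclotomicExtension_prime 3 _
    (by rw [classNumber_eq_one_of_isCyclotomicExtension_three, Nat.dvd_one]; decide) κE

/-- The companion conclusion of the `p = 3` form for the REAL quadratic subfield `L^{⟨z⟩}` (`μ₃(ℚ(√d)) = 0 ⟸ μ₃(ℚ(√−3d)) = 0`).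
[cite: Washington1997, §10.2 Thm. 10.10 (Scholz)] [cite: Lang1990, Ch. 13 §2, Thm. 2.1 (i)] -/
theorem classicalMuVanishes_of_isCyclotomic_real_of_imaginaryMirror_three [Fact (3 : ℕ).Prime] (L : Type) [Field L]
    [NumberField L] [IsGalois ℚ L] [IsTotallyComplex L] (h3L : ¬ 3 ∣ Module.finrank ℚ L) {ζ : L} (hζ : IsPrimitiveRoot ζ 3)
    {z b : L ≃ₐ[ℚ] L} (hz : z * z = 1) (hb : b * b = 1) (hzb : z * b = b * z) (hz1 : z ≠ 1)
    (hreal : IsTotallyReal ↥(fixedField (Subgroup.zpowers z)))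
    [IsCyclotomicExtension {3} ℚ ↥(fixedField (Subgroup.zpowers b))]
    (hμ : ∀ κE : ZpExtension ↥(fixedField (Subgroup.zpowers (z * b))) 3, κE.IsCyclotomic → ClassicalMuVanishes κE)
    (κZ : ZpExtension ↥(fixedField (Subgroup.zpowers z)) 3) (hκZ : κZ.IsCyclotomic) : ClassicalMuVanishes κZ := by
  refine classicalMuVanishes_of_isCyclotomic_real_of_mirror (p := 3) (by decide) L h3L hζ hz hb hzb hz1 hreal
    (fun κE _ => ?_) hμ κZ hκZ
  haveI : FiniteDimensional ℚ L := Module.Finite.of_restrictScalars_finite ℚ ℚ L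
  exact classicalMuVanishes_of_isCyclotomicExtension_prime 3 _
    (by rw [classNumber_eq_one_of_isCyclotomicExtension_three, Nat.dvd_one]; decide) κE


end Descent

end Literature.NumberTheory.IwasawaTheory

end
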